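import Literature.Analysis.FluidPDE.NSCriticalClosureBesovKatoClass
import Literature.Analysis.FluidPDE.TypeIAncientMild
import HarnessLib

/-!
# Route `SqueezeCycle` / `ClockStretchingLaw`, shared support `SingularZoom`
# (item stmt-NavierStokesRegularity-10573): reduction to ONE analytic statement, the singular
# Type-I zoom limit

`SingularZoom` says: if no element of the Type-I model class `𝒦_C` (smooth divergence-free
KNSS-mild ancient fields with the Type-I rate `|u| ≤ C/√(−t)` and scale-invariant local energies
`A, E ≤ C` on all backward cylinders with vertex time `≤ 0`) is unbounded at the space–time origin,
then a finite-energy classical solution on `[0, T)` from a rapidly decaying datum with the Type-I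
rate near `T` extends smoothly past `T`.

This helper file isolates the analytic content as the hypothesis `hZL` ("singular zoom limit",
Albritton–Barker 2019 §3 forward direction WITHOUT sup-normalisation + Koch–Nadirashvili–Seregin–
Šverák 2009 §6 compactness + Rusin–Šverák 2011 persistence of singularities): a classical
Leray–Hopf solution with the Type-I rate which is essentially unbounded on every backward parabolic
cylinder at a final-time point `(T, x₀)` has a zoom limit in some `𝒦_C` (tree form:
`Literature.Analysis.FluidPDE.IsTypeIAncientMild C ū` plus the two energy clauses) which is
unbounded at the origin. Given `hZL`, `SingularZoom` follows from Lemarié-Rieusset's continuation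
criterion "a finite maximal time carries a singular point"
(`hasSmoothExtensionPast_of_forall_exists_parabolicCylinder`) and the identification of the route's
inline class with the tree class (`isTypeIAncientMild_iff`, definitional). The statement proved is
`hZL → <SingularZoom verbatim>`; it imports no route file.
-/

noncomputable section

open MeasureTheory Set Function Filter Metric
open scoped ENNReal

namespace Summit.NavierStokesRegularity.NavierStokesRegularity.Theorems

open Literature.Analysis.FluidPDE

/-- **`SingularZoom` from the singular Type-I zoom limit.** Hypothesis `hZL`: for `ν > 0`, `T > 0`,
a classical solution `(u, p)` on `ℝ³ × [0, T)`, Leray–Hopf from a rapidly decaying datum, with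
`IsTypeIBlowup u T`, and a point `x₀` such that `u` is essentially unbounded on every backward
cylinder `Q_r(T, x₀)`, there are `C` and a Type-I KNSS-mild ancient field `ū`
(`IsTypeIAncientMild C ū`) with scaled energies `A, E ≤ C` on all backward cylinders with vertex
time `≤ 0` which is unbounded at the origin. Conclusion: the route statement `SingularZoom`
(shared item stmt-NavierStokesRegularity-10573), verbatim. Proof: if `u` did not extend, by
Lemarié-Rieusset 2016 Thm. 15.1 (C) (`hasSmoothExtensionPast_of_forall_exists_parabolicCylinder`)
some `(T, x₀)` has no bounded backward cylinder; `hZL` produces a singular element of `𝒦_C`,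
which the hypothesis of `SingularZoom` forbids. [cite: LemarieRieusset2016, Thm 15.1 (C); AlbrittonBarker2019, §3] -/
theorem singularZoom_of_zoomLimit
    (hZL : ∀ (ν T : ℝ), 0 < ν → 0 < T →
      ∀ (u : ℝ → EuclideanSpace ℝ (Fin 3) → EuclideanSpace ℝ (Fin 3))
        (p : ℝ → EuclideanSpace ℝ (Fin 3) → ℝ),
        IsClassicalNSSolutionOn (Ico 0 T) ν 0 u p → IsLerayHopfOn T ν 0 (u 0) u →
        HasRapidSpatialDecay (u 0) → IsTypeIBlowup u T →
        ∀ x₀ : EuclideanSpace ℝ (Fin 3),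
          (∀ r : ℝ, 0 < r →
            eLpNorm (uncurry u) ∞ (volume.restrict (parabolicCylinder r ((T : ℝ), x₀))) = ∞) →
          ∃ (C : ℝ) (ū : ℝ → EuclideanSpace ℝ (Fin 3) → EuclideanSpace ℝ (Fin 3)),
            IsTypeIAncientMild C ū ∧
            (∀ (x₁ : EuclideanSpace ℝ (Fin 3)) (t₀ r : ℝ), t₀ ≤ 0 → 0 < r →
              (∀ t, t₀ - r ^ 2 < t → t < t₀ → r⁻¹ * ∫ x in ball x₁ r, ‖ū t x‖ ^ 2 ≤ C) ∧
              r⁻¹ * ∫ t in Ioo (t₀ - r ^ 2) t₀, ∫ x in ball x₁ r, ‖fderiv ℝ (ū t) x‖ ^ 2 ≤ C) ∧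
            (∀ r > 0, ∀ M : ℝ, ∃ t ∈ Ioo (-(r ^ 2)) (0 : ℝ),
              ∃ x ∈ ball (0 : EuclideanSpace ℝ (Fin 3)) r, M < ‖ū t x‖)) :
    (∀ (C : ℝ) (u : ℝ → EuclideanSpace ℝ (Fin 3) → EuclideanSpace ℝ (Fin 3)), ContDiffOn ℝ (⊤ : ℕ∞) (Function.uncurry u) (Set.Iio 0 ×ˢ Set.univ) ∧ (∀ t < 0, Literature.Analysis.FluidPDE.VectorCalculus.IsDivFree (u t)) ∧ (∀ s t : ℝ, s < t → t < 0 → ∀ x, u t x = Literature.Analysis.FluidPDE.heatFlow (u s) (t - s) x - ∫ τ in Set.Ioo s t, ∫ y, ((-(inner ℝ (x - y) (u τ y) / (2 * (t - τ)) * Literature.Analysis.UnboundedOperators.heatKernel (t - τ) (x - y))) • u τ y + (∫ σ in Set.Ioi (t - τ), Literature.Analysis.UnboundedOperators.heatKernel σ (x - y) / (4 * σ ^ 2)) • (inner ℝ (x - y) (u τ y) • u τ y + inner ℝ (u τ y) (u τ y) • (x - y) + inner ℝ (x - y) (u τ y) • u τ y) - ((∫ σ in Set.Ioi (t - τ), Literature.Analysis.UnboundedOperators.heatKernel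 σ (x - y) / (8 * σ ^ 3)) * (inner ℝ (x - y) (u τ y) * inner ℝ (x - y) (u τ y))) • (x - y))) ∧ Literature.Analysis.FluidPDE.HasTypeITimeDecay C u ∧ (∀ (x₀ : EuclideanSpace ℝ (Fin 3)) (t₀ r : ℝ), t₀ ≤ 0 → 0 < r → (∀ t, t₀ - r ^ 2 < t → t < t₀ → r⁻¹ * ∫ x in Metric.ball x₀ r, ‖u t x‖ ^ 2 ≤ C) ∧ r⁻¹ * ∫ t in Set.Ioo (t₀ - r ^ 2) t₀, ∫ x in Metric.ball x₀ r, ‖fderiv ℝ (u t) x‖ ^ 2 ≤ C) → ¬ (∀ r > 0, ∀ M : ℝ, ∃ t ∈ Set.Ioo (-(r ^ 2)) (0 : ℝ), ∃ x ∈ Metric.ball (0 : EuclideanSpace ℝ (Fin 3)) r, M < ‖u t x‖)) → ∀ (ν T : ℝ), 0 < ν → 0 < T → ∀ (u : ℝ → EuclideanSpace ℝ (Fin 3) → EuclideanSpace ℝ (Fin 3)) (p : ℝ → EuclideanSpace ℝ (Fin 3) → ℝ), Literature.Analysis.FluidPDE.IsClassicalNSSolutionOn (Set.Ico 0 T) ν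 0 u p → Literature.Analysis.FluidPDE.IsLerayHopfOn T ν 0 (u 0) u → Literature.Analysis.FluidPDE.HasRapidSpatialDecay (u 0) → Literature.Analysis.FluidPDE.IsTypeIBlowup u T → Literature.Analysis.FluidPDE.HasSmoothExtensionPast ν 0 u T := by
  intro hK ν T hν hT u p hcl hLH hdec hTI
  apply hasSmoothExtensionPast_of_forall_exists_parabolicCylinder hν hT hcl hLH hdec
  intro x₀
  by_contra hno
  push Not at hno
  have hsing : ∀ r : ℝ, 0 < r →
      eLpNorm (uncurry u) ∞ (volume.restrict (parabolicCylinder r ((T : ℝ), x₀))) = ∞ :=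
    fun r hr => top_le_iff.1 (hno r hr)
  obtain ⟨C, ū, hmild, hAE, hs⟩ := hZL ν T hν hT u p hcl hLH hdec hTI x₀ hsing
  obtain ⟨h1, h2, h3, h4⟩ := (isTypeIAncientMild_iff).1 hmild
  exact hK C ū ⟨h1, h2, fun s t hst ht x => h3 s t hst ht x, h4, hAE⟩ hs

end Summit.NavierStokesRegularity.NavierStokesRegularity.Theorems

end
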